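import Summits.BirchSwinnertonDyer.BirchSwinnertonDyer.Theorems.EisensteinPrimesGoodLatticeBDPValueOfNamedFactsV32
import Summits.BirchSwinnertonDyer.BirchSwinnertonDyer.Theorems.EisensteinPrimesGoodLatticeBDPValueOfKatzUnitOfPoitouTateAt
import HarnessLib

/-!
# Crux `GoodLatticeBDPValue` (stmt-BirchSwinnertonDyer-19032), line `halves`: THE CRUX BY NAME FROM SEVEN LITERATURE NAMED FACTS —
# research 5 · preprint-grade 1 · TEXTBOOK 1 — Greenberg 2016 Prop. 4.1.1 (halves v32 stub 4) is NO LONGER among them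

Cell `bsd-eis` (run/shared/lean/pub/bsd-eis/), width seat `bsd-line-x1-p1-w5` gen 12 (free hand; director-bsd g19 2026-08-29 (3), cruxlead-20395 g7's
pointer). `--supports stmt-BirchSwinnertonDyer-19032`.  A by-name closure PRE-STAGED for the LEAD's next registry touch (v33 / v33N): it is
LEAD g10's `GoodLatticeBDPValueOfNamedFactsV32.goodLatticeBDPValue_of_namedFacts₃₂` with the binder
`(stub_publishedFactsGreenberg : prop411_selmer_isAlmostDivisible)` DELETED — the crux `Theses.EisensteinPrimes.GoodLatticeBDPValue` from the
three other v32 stub statements VERBATIM: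

* stub 1 `stub_publishedFacts` (CGLS 2022 proof of Thm. 4.2.2, Thm. 5.1.3 (disc); Bleher et al. 2020 Thm. 3.3.1; de Shalit 1987 II.6.4 — research 4);
* stub 3a-A `stub_anacongOfFullDescentDatum` (`KellerYin2024.thm222_anacong_goodLattice_of_fullDescentDatum` — composed-print 1);
* stub 4b `stub_publishedFactsMore` (Milne ADT I Thm. 4.10 (a) at finite `S` of totally complex fields — textbook 1, the END-theorem type of lane
  «PT-Ш-S-TC» —; CGLS 2022 Thm. 2.1.2 — research 1).

WHY stub 4 is droppable: on the line Greenberg 2016 Prop. 4.1.1 was consumed at ONE instance (road (γ), case (c), the scalar-model twist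
deformation over `Λ₂` at the imaginary quadratic `K`, where `H²(K_Σ/K, 𝐃) = 0`); there its conclusion is the tree theorem
`Greenberg2016.selmer_isAlmostDivisible_caseC_of_prop321_of_isCotorsion_H_two'` (cell `pub/bsd-wall`, p728036) fed [Gr5] Prop. 3.2.1 (c) at `K`,
itself this line's road «SUR-Λ» fed Milne I 4.10 (a) at `(K, S)` (`UniversalToricDescentThinComb.NoPseudoNullOfPoitouTate.prop321_caseC_of_poitouTateAt`,
p728414) — so the textbook conjunct of stub 4b, already on the surface, now feeds BOTH road «SUR-Λ» (Prop. 2.6.3 (c)) and road (γ).  Composition: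
`GoodLatticeBDPValueOfNamedFactsV28.goodLatticeBDPValue_of_namedFacts₂₈_ofSurC`'s body with the terminal closer replaced by this seat's
`GoodLatticeBDPValueOfKatzUnit.goodLatticeBDPValue_of_print_of_leTD_of_le_of_anQ_of_katzUnit_ofPoitouTateAt` (slot `h411` ↦ `stub_publishedFactsMore.1`)
and the six remaining Greenberg-type conjuncts supplied by their tree theorems (`prop422_localCohomology_isAlmostDivisible_holds`,
`sec5A_localH2_subsingleton_of_LOC1_holds`, `prop41_of_tate_of_poitouTate_three_le_of_isTotallyComplex` over Milne I 5.1 / Harari 17.13 (a) at totally complex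
fields, `prop42_localEulerPoincareCorank_holds`, Bleher et al. §3.3 from stub 1's Thm. 3.3.1, (T4) `…above_cyclotomic_of_isOpen_holds`).
When the lane's END theorem `PoitouTateShaNaturalAtTC.forall_poitouTate_shaRestricted_tateDual_natural_at_of_isTotallyComplex` is accepted, feeding it to
`stub_publishedFactsMore.1` leaves SIX names (research 5 · composed-print 1 · textbook 0).

CONDITIONAL on exactly these seven names (audit `proof.conditional`); closes nothing by itself; no summit statement / BSD / IMC2 / Keller–Yin 3.0.8 / the
crux is proved here; 0 cells / labels / tiers move.  [claim: KellerYin2024, status: under-review]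
[cite: KellerYin2024, Thm. 3.0.8 (IMC2)] [cite: CastellaGrossiLeeSkinner2022, proof of Thm. 4.2.2, Thm. 5.1.3 with §2 (disc), Thm. 2.1.2]
[cite: BleherEtAl2020, §3.3 Thm. 3.3.1] [cite: deShalit1987, II.6.4 Theorem (i)] [cite: Greenberg2016Selmer, Prop. 4.1.1 (c), Prop. 2.6.3 (c)]
[cite: Greenberg2010, Prop. 3.2.1 (c)] [cite: Greenberg2006, Prop. 6.10, Props. 4.1, 4.2, §5 A] [cite: MilneADT2006, I Thm. 4.10 (a), I Thm. 5.1]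
[cite: Harari2020, Thm. 17.13 (a), Cor. 17.14] [cite: Kriz2016, Thm. 3, Def. 31 (5), Thm. 34 (3), Thm. 35]
-/

-- `Summit.<P>.<Sub>` repeats `BirchSwinnertonDyer` by the tree's layout convention (D-0017)
set_option autoImplicit false
set_option linter.dupNamespace false

noncomputable section

namespace Summit.BirchSwinnertonDyer.BirchSwinnertonDyer.Theorems.GoodLatticeBDPValueOfNamedFactsV33P

open NumberField Literature.NumberTheory.EllipticCurves.CastellaGrossiLeeSkinner2022 Literature.NumberTheory.EllipticCurves.BCGKPST2020
  Literature.NumberTheory.EllipticCurves.DeShalit1987 Literature.NumberTheory.EllipticCurves.KellerYin2024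
  Literature.NumberTheory.IwasawaTheory.Greenberg2016 Literature.NumberTheory.IwasawaTheory.Greenberg2006
  Literature.NumberTheory.GaloisRepresentations Literature.NumberTheory.GaloisCohomology
  Summit.BirchSwinnertonDyer.Rank1Residual.X1.KellerYinHalves
  Summit.BirchSwinnertonDyer.BirchSwinnertonDyer.Theorems
  Summit.BirchSwinnertonDyer.BirchSwinnertonDyer.Theorems.GoodLatticeImprimitiveOfQuotient
  Summit.BirchSwinnertonDyer.BirchSwinnertonDyer.Theorems.GoodLatticeQuotientOfCorank
  Summit.BirchSwinnertonDyer.BirchSwinnertonDyer.Theorems.GoodLatticeCorankOfGe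

/-- **THE CRUX BY NAME — `Theses.EisensteinPrimes.GoodLatticeBDPValue` — from SEVEN LITERATURE NAMED FACTS (research 5 · composed-print 1 · textbook 1):
halves v32's by-name closure `GoodLatticeBDPValueOfNamedFactsV32.goodLatticeBDPValue_of_namedFacts₃₂` with the stub-4 binder
`(stub_publishedFactsGreenberg : prop411_selmer_isAlmostDivisible)` DELETED** — Greenberg 2016 Prop. 4.1.1 (c)'s conclusion at the line's one
instance comes from the textbook conjunct `stub_publishedFactsMore.1` (Milne ADT I Thm. 4.10 (a) at finite `S`, totally complex) through
[Gr5] Prop. 3.2.1 (c) (road «SUR-Λ») and Greenberg 2006 Prop. 6.10 with `Σ' = ∅` (tree theorems p714471 / p728414 / p728036), via this seat's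
re-typed closer `goodLatticeBDPValue_of_print_of_leTD_of_le_of_anQ_of_katzUnit_ofPoitouTateAt`; everything else as in
`GoodLatticeBDPValueOfNamedFactsV28.goodLatticeBDPValue_of_namedFacts₂₈_ofSurC`. CONDITIONAL on exactly these seven names; closes nothing by
itself; BSD is proved for no curve. [claim: KellerYin2024, status: under-review]
[cite: KellerYin2024, Thm. 3.0.8 (IMC2)] [cite: Greenberg2016Selmer, Prop. 4.1.1 (c), Prop. 2.6.3 (c)] [cite: Greenberg2010, Prop. 3.2.1 (c)]
[cite: Greenberg2006, Prop. 6.10, Props. 4.1, 4.2, §5 A] [cite: MilneADT2006, I Thm. 4.10 (a), I Thm. 5.1] [cite: Harari2020, Thm. 17.13 (a)] -/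
theorem goodLatticeBDPValue_of_namedFacts₃₃ₚ
    (stub_publishedFacts :
      proofThm422_exists_isBDPLFunction_isTorsion_charIdeal_dvd ∧
        thm513_exists_isBDPLFunction_valueAtOne_disc ∧
        thm331_rubin_exists_katzMeasure₂_pseudoIso_span_eq ∧
        thmII64_katzMeasure₂_functionalEquation)
    (stub_anacongOfFullDescentDatum : thm222_anacong_goodLattice_of_fullDescentDatum)
    (stub_publishedFactsMore : (∀ (L : Type) [Field L] [NumberField L] [IsTotallyComplex L] (S : Set (IsDedekindDomain.HeightOneSpectrum (𝓞 L))),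
      S.Finite → Literature.NumberTheory.GaloisCohomology.poitouTate_shaRestricted_tateDual_natural_at L S) ∧ thm212_exists_isKatzLFunction) :
    Summit.BirchSwinnertonDyer.BirchSwinnertonDyer.Theses.EisensteinPrimes.GoodLatticeBDPValue := by
  -- Greenberg 2016 Prop. 2.6.3 (c) at totally complex fields from the textbook conjunct (road «SUR-Λ», v32 END-COMPOSE)
  have h263 : prop263_sur_of_crk_caseC_tc :=
    Summit.BirchSwinnertonDyer.BirchSwinnertonDyer.Theorems.SurLambda.prop263_sur_of_crk_caseC_tc_of_poitouTateNaturalAt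
      stub_publishedFactsMore.1
  -- Milne I 5.1 and Harari 17.13 (a) at totally complex fields: tree theorems
  have hT : ∀ (L : Type) [Field L] [NumberField L] [IsTotallyComplex L], tateGlobalEulerPoincareCharacteristic L :=
    Literature.NumberTheory.GaloisCohomology.forall_tateGlobalEulerPoincareCharacteristic_of_isTotallyComplex
  have ha : ∀ (L : Type) [Field L] [NumberField L] [IsTotallyComplex L], poitouTate_restricted_three_le L :=
    Literature.NumberTheory.GaloisCohomology.forall_poitouTate_restricted_three_le_of_isTotallyComplex
  -- the six Greenberg-type conjuncts other than Prop. 4.1.1: tree theorems / stub 1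
  have h422 : prop422_localCohomology_isAlmostDivisible := prop422_localCohomology_isAlmostDivisible_holds
  have h5A : sec5A_localH2_subsingleton_of_LOC1 := sec5A_localH2_subsingleton_of_LOC1_holds
  have h41 : prop41_globalEulerPoincareCorank := prop41_of_tate_of_poitouTate_three_le_of_isTotallyComplex hT ha
  have h42 : prop42_localEulerPoincareCorank := prop42_localEulerPoincareCorank_holds
  have h33 : Literature.NumberTheory.EllipticCurves.BCGKPST2020.sec33_rubin_unrSelmer₂_finite_torsion :=
    GoodLatticeBDPValueSec33OfThm331.sec33_of_thm331 stub_publishedFacts.2.2.1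
  have hT4 : weakLeopoldt_H2_subsingleton_above_cyclotomic_of_isOpen :=
    GoodLatticeBDPValueStagesDie.weakLeopoldt_H2_subsingleton_above_cyclotomic_of_isOpen_holds
  -- [AN] at every odd `p`: 3a-A BY NAME at the datum of the closed 3a-B, and its `5 ≤ p` slice via the T‴ bridge
  have h5 : thm222_anacong_goodLattice_of_five_le :=
    GoodLatticeBDPValueFullDescentFiveLe.thm222_anacong_goodLattice_of_five_le_of_fullDescentDatum stub_anacongOfFullDescentDatum
  have han : thm222_anacong_goodLattice_OPEN :=
    GoodLatticeBDPValueAnThreeBookkeeping.thm222_OPEN_of_fullDescentDatum_of_five_le stub_anacongOfFullDescentDatum h5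
  exact GoodLatticeBDPValueOfKatzUnit.goodLatticeBDPValue_of_print_of_leTD_of_le_of_anQ_of_katzUnit_ofPoitouTateAt
    stub_publishedFacts.1 stub_publishedFacts.2.1 stub_publishedFacts.2.2.1 stub_publishedFacts.2.2.2
    (GoodLatticeBDPValueKatzUnitSuppliers.katzUnitAll_of_anacong han stub_publishedFactsMore.2)
    stub_publishedFactsMore.1 h422 h5A h41 h42 h33 hT4
    (GoodLatticeBDPValueOfNamedFactsV28.imprimLambdaLE_of_facts_ofSurC h263 hT ha)
    (prop125_imprimitive_of_quotient
      (prop125_quotient_of_corank (prop125_corank_of_ge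
        (AcTwistDeformation.prop125_residualPair_unrSelmer_corank_ge_of_facts_ofSurC h263 h41 h42 h5A hT))))
    FSideCorankLe.stub_fSideCorankLe
    (GoodLatticeBDPValueOfNamedFactsSix.anQ_of_thm222_OPEN stub_publishedFacts.2.2.2 han stub_publishedFactsMore.2)

end Summit.BirchSwinnertonDyer.BirchSwinnertonDyer.Theorems.GoodLatticeBDPValueOfNamedFactsV33P

end
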